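import Mathlib.RingTheory.TensorProduct.Quotient
import Mathlib.RingTheory.TensorProduct.MvPolynomial
import Mathlib.RingTheory.Polynomial.UniqueFactorization
import Mathlib.Algebra.MvPolynomial.Nilpotent
import Mathlib.FieldTheory.IsAlgClosed.AlgebraicClosure
import Literature.FieldTheory.Regular.AlgClosedTensorDomain
import Literature.NumberTheory.DiophantineGeometry.CafureMatera
import HarnessLib

/-!
# Towards Kaltofen's Theorem 7 (effective Noether forms): proofs, part 1 — base change of
# absolute irreducibility

Sibling proof file of `KaltofenNoetherForms.lean`, working towards the named fact
`Literature.RingTheory.MvPolynomial.kaltofen1995_thm7` (E. Kaltofen, *Effective Noether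
irreducibility forms and applications*, J. Comput. System Sci. 50 (1995) 274–295, §5 Thm. 7).

## What is proved here (sorry-free, no definitions, no named facts)

The first input of Kaltofen's Lemma 7 (§5, p. 23: "Note that absolute irreducibility is
invariant to coefficient field extension"):

* `irreducible_map_of_isAlgClosed` — over an algebraically closed field `k`, an irreducible
  `f ∈ k[X_σ]` stays irreducible in `K[X_σ]` for every field extension `K/k`
  (`k[X]/(f)` is a domain, hence so is `K ⊗ₖ k[X]/(f) ≅ K[X]/(f)` by
  `Literature.FieldTheory.Regular.isDomain_tensorProduct_of_isAlgClosed`, so `f` is prime in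
  `K[X]`);
* `irreducible_of_irreducible_map` — descent: if `f` becomes irreducible over an extension it
  is irreducible;
* `IsAbsIrreducible.irreducible_map` — an absolutely irreducible `f ∈ K[X₁, …, Xₙ]`
  (irreducible over `K̄`) is irreducible over EVERY field extension of `K`.

## References

* E. Kaltofen, J. Comput. System Sci. 50 (1995) 274–295, §5 (proof of Lemma 7). [Kaltofen1995]
* S. Lang, *Algebra*, GTM 211, VIII §4, Cor. 4.14. [Lang2002]
-/

noncomputable section

open MvPolynomial
open scoped TensorProduct

universe u

namespace Literature.RingTheory.MvPolynomial

open Literature.NumberTheory.DiophantineGeometry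

/-! ### Irreducibility over an algebraically closed field is absolute -/

/-- **Base change of irreducibility from an algebraically closed field.** If `k` is
algebraically closed and `f ∈ k[X_σ]` is irreducible, then `f` stays irreducible in `K[X_σ]`
for every field `K` receiving a ring map `ι : k → K`. (The quotient `k[X]/(f)` is a domain;
over an algebraically closed field the tensor product of domains `K ⊗ₖ k[X]/(f) ≅ K[X]/(f)` is
again a domain, so `f` is prime in `K[X]`.) [cite: Lang2002, VIII §4 Cor. 4.14] -/
theorem irreducible_map_of_isAlgClosed {k : Type*} [Field k] [IsAlgClosed k] {K : Type*}
    [Field K] (ι : k →+* K) {σ : Type*} {f : MvPolynomial σ k} (hf : Irreducible f) :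
    Irreducible (MvPolynomial.map ι f) := by
  classical
  letI : Algebra k K := ι.toAlgebra
  have hι : algebraMap k K = ι := rfl
  -- `f` is prime, so `k[X]/(f)` is a domain
  set I : Ideal (MvPolynomial σ k) := Ideal.span {f} with hI
  haveI hIp : I.IsPrime :=
    (Ideal.span_singleton_prime hf.ne_zero).2 (UniqueFactorizationMonoid.irreducible_iff_prime.1 hf)
  haveI : IsDomain (MvPolynomial σ k ⧸ I) := (Ideal.Quotient.isDomain_iff_prime I).2 hIp
  -- hence `K ⊗ₖ k[X]/(f)` is a domain
  haveI : IsDomain (K ⊗[k] (MvPolynomial σ k ⧸ I)) :=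
    Literature.FieldTheory.Regular.isDomain_tensorProduct_of_isAlgClosed k _ K
  -- `K ⊗ₖ k[X]/(f) ≅ (K ⊗ₖ k[X]) / (f) ≅ K[X]/(f)`
  let e₁ : K ⊗[k] (MvPolynomial σ k ⧸ I) ≃ₐ[K] (K ⊗[k] MvPolynomial σ k) ⧸ I.map
      (Algebra.TensorProduct.includeRight : MvPolynomial σ k →ₐ[k] K ⊗[k] MvPolynomial σ k) :=
    Algebra.TensorProduct.tensorQuotientEquiv (R := k) K (MvPolynomial σ k) K I
  let e₂ : K ⊗[k] MvPolynomial σ k ≃ₐ[K] MvPolynomial σ K := MvPolynomial.algebraTensorAlgEquiv k K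
  have he₂ : e₂ (1 ⊗ₜ f) = MvPolynomial.map ι f := by
    simp [e₂, MvPolynomial.algebraTensorAlgEquiv_tmul, hι]
  have hJ : (Ideal.span {MvPolynomial.map ι f} : Ideal (MvPolynomial σ K)) =
      (I.map (Algebra.TensorProduct.includeRight :
        MvPolynomial σ k →ₐ[k] K ⊗[k] MvPolynomial σ k)).map
        (e₂ : K ⊗[k] MvPolynomial σ k →+* MvPolynomial σ K) := by
    rw [hI, Ideal.map_span, Set.image_singleton, Ideal.map_span, Set.image_singleton, ← he₂]
    rfl
  let e₃ := Ideal.quotientEquivAlg _ _ e₂ hJ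
  haveI : IsDomain (MvPolynomial σ K ⧸ Ideal.span {MvPolynomial.map ι f}) :=
    MulEquiv.isDomain (K ⊗[k] (MvPolynomial σ k ⧸ I)) (e₁.trans e₃).symm.toMulEquiv
  have hne : MvPolynomial.map ι f ≠ 0 := fun h =>
    hf.ne_zero (MvPolynomial.map_injective ι ι.injective (by rw [h, map_zero]))
  exact ((Ideal.span_singleton_prime hne).1
    ((Ideal.Quotient.isDomain_iff_prime _).1 inferInstance)).irreducible

/-- Base change along an injective ring map preserves the total degree. [folklore] -/
theorem totalDegree_map_of_injective' {A B : Type*} [CommSemiring A] [CommSemiring B]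
    {σ : Type*} (f : MvPolynomial σ A) {φ : A →+* B} (hφ : Function.Injective φ) :
    (MvPolynomial.map φ f).totalDegree = f.totalDegree := by
  rw [MvPolynomial.totalDegree, MvPolynomial.totalDegree, MvPolynomial.support_map_of_injective _ hφ]

/-- Units of `K[X_σ]` over a field are detected after an (injective) extension of scalars.
[folklore] -/
theorem isUnit_of_isUnit_map {K L : Type*} [Field K] [Field L] (ι : K →+* L) {σ : Type*}
    {p : MvPolynomial σ K} (hp : IsUnit (MvPolynomial.map ι p)) : IsUnit p := by
  rw [MvPolynomial.isUnit_iff_totalDegree_of_isReduced] at hp ⊢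
  rw [MvPolynomial.coeff_map, totalDegree_map_of_injective' _ ι.injective] at hp
  exact ⟨((map_ne_zero ι).1 hp.1.ne_zero).isUnit, hp.2⟩

/-- **Descent of irreducibility.** If `f ∈ K[X_σ]` becomes irreducible over a field extension
`L` of `K`, then `f` is irreducible over `K`. [folklore] -/
theorem irreducible_of_irreducible_map {K L : Type*} [Field K] [Field L] (ι : K →+* L)
    {σ : Type*} {f : MvPolynomial σ K} (hf : Irreducible (MvPolynomial.map ι f)) :
    Irreducible f := by
  refine ⟨fun hu => hf.not_isUnit (hu.map (MvPolynomial.map ι)), fun a b hab => ?_⟩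
  have := hf.isUnit_or_isUnit (show _ = MvPolynomial.map ι a * MvPolynomial.map ι b by
    rw [hab, map_mul])
  exact this.imp (isUnit_of_isUnit_map ι) (isUnit_of_isUnit_map ι)

/-- **Absolute irreducibility is invariant under extension of the coefficient field**
(Kaltofen 1995, proof of Lemma 7: "absolute irreducibility is invariant to coefficient field
extension"): if `f ∈ K[X₁, …, Xₙ]` is irreducible over `K̄` then it is irreducible over every
field `L ⊇ K`. (Embed `L` in `L̄`, map `K̄ → L̄`; irreducibility passes from `K̄` up to `L̄` by
`irreducible_map_of_isAlgClosed` and down to `L` by `irreducible_of_irreducible_map`.) [cite: Kaltofen1995, §5 (proof of Lemma 7)] -/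
theorem _root_.Literature.NumberTheory.DiophantineGeometry.IsAbsIrreducible.irreducible_map
    {K : Type u} [Field K] {n : ℕ} {f : MvPolynomial (Fin n) K} (hf : IsAbsIrreducible f)
    {L : Type*} [Field L] (ι : K →+* L) : Irreducible (MvPolynomial.map ι f) := by
  letI : Algebra K L := ι.toAlgebra
  have hι : algebraMap K L = ι := rfl
  letI : Algebra K (AlgebraicClosure L) := (algebraMap L (AlgebraicClosure L)).comp ι |>.toAlgebra
  have hKL : algebraMap K (AlgebraicClosure L) = (algebraMap L (AlgebraicClosure L)).comp ι := rfl
  -- `K̄ → L̄` over `K`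
  let j : AlgebraicClosure K →ₐ[K] AlgebraicClosure L := IsAlgClosed.lift
  have hup : Irreducible (MvPolynomial.map (algebraMap K (AlgebraicClosure L)) f) := by
    have h1 := irreducible_map_of_isAlgClosed (j : AlgebraicClosure K →+* AlgebraicClosure L) hf
    rwa [MvPolynomial.map_map, AlgHom.comp_algebraMap_of_tower] at h1
  rw [hKL, ← MvPolynomial.map_map] at hup
  exact irreducible_of_irreducible_map _ hup

end Literature.RingTheory.MvPolynomial

end
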